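import Mathlib.Analysis.Complex.Basic
import Mathlib.Analysis.Calculus.Deriv.Add
import Mathlib.Analysis.Calculus.Deriv.Inv
import Mathlib.Analysis.Calculus.FDeriv.Mul
import Mathlib.Analysis.Calculus.ContDiff.Defs
import Mathlib.Analysis.Analytic.Constructions
import Mathlib.Analysis.Analytic.Linear
import HarnessLib

/-!
# The equivariant exponential chart of maps of the projective line near the identity

A tangent vector to `ℂℙ¹` at the point with affine coordinate `z` is written `c ∂_z`
(`c ∈ ℂ`); in the other affine chart `w = 1/z` the same vector is `c₁ ∂_w` with
`c₁ = -w² c`.  Using the Fubini–Study Hermitian structure of `ℂℙ¹ = ℙ(ℂ²)` (the unitary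
frame `(1, z)/‖(1, z)‖`, `(-conj z, 1)/‖(1, z)‖` at the line spanned by `(1, z)`), the
"exponential" of `c ∂_z` at `z` is the line spanned by `(1, z) + c • (-conj z, 1)/(1 + |z|²)`,
i.e. the affine point

  `expChart z c = (z * (1 + |z|²) + c) / (1 + |z|² - c * conj z)`,   `|z|² = Complex.normSq z`.

This is the unitarily natural affine chart of `ℂℙ¹` centred at `z` (it differs from the
Riemannian exponential map of the Fubini–Study metric only by a radial reparametrisation of
each tangent line, which we do not need).  Its point is the **equivariance under the chart
change** `z ↦ 1/z` (a unitary map of `ℂ²`, namely the coordinate swap):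

  `1 / expChart z c = expChart (1/z) (-(1/z)² c)`,

so that `ξ ↦ (z ↦ expChart z (ξ₀ z))` is a globally consistent parametrisation of maps
`S² → ℂℙ¹` near the identity by sections `ξ = (ξ₀, ξ₁)`, `ξ₁ w = -w² ξ₀ w⁻¹`, of the tangent
bundle.  This is the domain-reparametrisation unknown in implicit-function-theorem
constructions of `J`-holomorphic spheres (Wendl (2018), §2.6).

## Contents

* `den z c = 1 + |z|² - c * conj z`, `expChart z c` (junk value `0` where `den z c = 0`,
  inherited from `x / 0 = 0`).
* `expChart_zero : expChart z 0 = z`, `den_zero`, `den_zero_ne_zero`.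
* nondegeneracy: `le_norm_den` (`(1 + ‖z‖²)/2 ≤ ‖den z c‖` as soon as
  `‖c‖ ‖z‖ ≤ (1 + ‖z‖²)/2`), `den_ne_zero_of_norm_le`, `den_ne_zero_of_norm_le_three`
  (`‖z‖ ≤ 3`, `‖c‖ ≤ 1/6`).
* equivariance: `inv_expChart : (expChart z c)⁻¹ = expChart z⁻¹ (-(z⁻¹)² * c)` for `z ≠ 0`
  (no further hypothesis is needed thanks to the conventions `x / 0 = 0⁻¹ = 0`), and
  `den_inv_ne_zero` (the right-hand side is an honest value as soon as the numerator
  `z (1 + |z|²) + c` of the left-hand side is nonzero), `inv_expChart_inv`.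
* values: `expChart_sub_self`, `norm_expChart_sub_self_le : ‖expChart z c - z‖ ≤ 2 ‖c‖`,
  `expChart_sub_expChart`, `norm_expChart_sub_expChart_le` (`4`-Lipschitz in `c`).
* derivatives in `c`: `hasDerivAt_expChart` (`∂_c expChart z c = (1 + |z|²)² / den²`),
  `hasDerivAt_expChart_zero : ∂_c expChart z 0 = 1`, `hasFDerivAt_expChart_zero_right`
  (the real differential in `c` at `c = 0` is the identity), `hasFDerivAt_expChart_zero_left`.
* smoothness: `analyticAt_expChart`, `contDiffAt_expChart` (every `n : WithTop ℕ∞`),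
  `contDiffOn_expChart` (`C^∞` on the open set `{den ≠ 0}`, `isOpen_den_ne_zero`;
  `contDiffOn_expChart'` for every `n`), `analyticOnNhd_expChart`, `analyticOn_expChart`,
  `differentiableAt_expChart_right` (holomorphy in `c`).
* the full real differential: `fderivExpChart p : ℂ × ℂ →L[ℝ] ℂ`, `hasFDerivAt_expChart`,
  `fderiv_expChart`, `fderivExpChart_apply`, and
  `fderivExpChart_zero_apply : fderivExpChart (z, 0) (a, b) = a + b` (at `c = 0` the
  differential is `(δz, δc) ↦ δz + δc`, `hasFDerivAt_expChart_zero`); chain rule along a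
  section `hasFDerivAt_expChart_comp` and its linearisation at the zero section
  `hasFDerivAt_expChart_comp_of_eq_zero` (`d(expChart · (ξ ·)) = id + dξ` where `ξ = 0`).

## References

* P. Griffiths, J. Harris, *Principles of Algebraic Geometry* (1978), Ch. 0 §2 (the
  Fubini–Study metric of projective space). [GriffithsHarrisPrinciples1978]
* C. Wendl, *Holomorphic Curves in Low Dimensions*, LNM 2216 (2018), §2.6 (local existence of
  holomorphic spheres by the implicit function theorem). [Wendl2018]

All statements below are elementary algebra and calculus; we tag them `[folklore]`.
-/

noncomputable section

open Complex
open scoped ComplexConjugate ContDiff Topology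

namespace Literature.Analysis.Complex

namespace ProjectiveLineExpChart

/-! ### Definitions and values at `c = 0` -/

/-- The denominator `den z c = 1 + |z|² - c * conj z` of the exponential chart `expChart`
(`|z|² = Complex.normSq z`, cast to `ℂ`). [folklore] -/
def den (z c : ℂ) : ℂ := 1 + (Complex.normSq z : ℂ) - c * (starRingEnd ℂ) z

/-- The **exponential chart** of the projective line at the affine point `z` applied to the
tangent vector `c ∂_z`: the affine coordinate of the line spanned by
`(1, z) + c • (-conj z, 1) / (1 + |z|²) ∈ ℂ²`, namely
`expChart z c = (z * (1 + |z|²) + c) / (1 + |z|² - c * conj z)`.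
Junk value `0` when `den z c = 0` (Lean's `x / 0 = 0`), i.e. when the image point is the point
at infinity of the `z`-chart. [folklore] -/
def expChart (z c : ℂ) : ℂ := (z * (1 + (Complex.normSq z : ℂ)) + c) / den z c

/-- `den z c` written with `z * conj z` in place of `|z|²`. [folklore] -/
theorem den_eq (z c : ℂ) : den z c = 1 + z * conj z - c * conj z := by
  simp only [den, Complex.mul_conj]

/-- `expChart z c` written with `z * conj z` in place of `|z|²`. [folklore] -/
theorem expChart_eq (z c : ℂ) :
    expChart z c = (z * (1 + z * conj z) + c) / (1 + z * conj z - c * conj z) := by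
  simp only [expChart, den, Complex.mul_conj]

/-- At `c = 0` the denominator is `1 + |z|²`. [folklore] -/
theorem den_zero (z : ℂ) : den z 0 = 1 + (Complex.normSq z : ℂ) := by
  simp [den]

/-- `1 + |z|² ≠ 0` in `ℂ`. [folklore] -/
theorem one_add_normSq_ne_zero (z : ℂ) : (1 + (Complex.normSq z : ℂ)) ≠ 0 := by
  have h : (0 : ℝ) < 1 + Complex.normSq z := add_pos_of_pos_of_nonneg one_pos (normSq_nonneg z)
  exact_mod_cast h.ne'

/-- At `c = 0` the denominator does not vanish. [folklore] -/
theorem den_zero_ne_zero (z : ℂ) : den z 0 ≠ 0 := by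
  rw [den_zero]
  exact one_add_normSq_ne_zero z

/-- The exponential chart is the identity at `c = 0`: `expChart z 0 = z`. [folklore] -/
@[simp]
theorem expChart_zero (z : ℂ) : expChart z 0 = z := by
  rw [expChart, add_zero, den_zero, mul_div_cancel_right₀ _ (one_add_normSq_ne_zero z)]

/-- As a function of `z`, `expChart · 0` is the identity map. [folklore] -/
theorem expChart_zero_eq_id : (fun z : ℂ => expChart z 0) = id :=
  funext expChart_zero

/-- Where the denominator is nonzero, `expChart z c = 0` exactly when the numerator
`z (1 + |z|²) + c` vanishes. [folklore] -/
theorem expChart_eq_zero_iff {z c : ℂ} (h : den z c ≠ 0) :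
    expChart z c = 0 ↔ z * (1 + (Complex.normSq z : ℂ)) + c = 0 := by
  rw [expChart, div_eq_zero_iff, or_iff_left h]

/-! ### Nondegeneracy of the denominator -/

/-- `‖1 + |z|²‖ = 1 + ‖z‖²`. [folklore] -/
theorem norm_one_add_normSq (z : ℂ) : ‖(1 + (Complex.normSq z : ℂ))‖ = 1 + ‖z‖ ^ 2 := by
  rw [normSq_eq_norm_sq]
  have h : (0 : ℝ) ≤ 1 + ‖z‖ ^ 2 := by positivity
  exact_mod_cast Complex.norm_of_nonneg h

/-- Quantitative nondegeneracy: if `‖c‖ ‖z‖ ≤ (1 + ‖z‖²)/2` then `(1 + ‖z‖²)/2 ≤ ‖den z c‖`.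
[folklore] -/
theorem le_norm_den {z c : ℂ} (h : ‖c‖ * ‖z‖ ≤ (1 + ‖z‖ ^ 2) / 2) :
    (1 + ‖z‖ ^ 2) / 2 ≤ ‖den z c‖ := by
  have h2 : ‖c * conj z‖ = ‖c‖ * ‖z‖ := by rw [norm_mul, norm_conj]
  calc (1 + ‖z‖ ^ 2) / 2 ≤ (1 + ‖z‖ ^ 2) - ‖c‖ * ‖z‖ := by linarith
    _ = ‖(1 + (Complex.normSq z : ℂ))‖ - ‖c * conj z‖ := by rw [norm_one_add_normSq, h2]
    _ ≤ ‖(1 + (Complex.normSq z : ℂ)) - c * conj z‖ := norm_sub_norm_le _ _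

/-- If `‖c‖ ‖z‖ ≤ (1 + ‖z‖²)/2` then `den z c ≠ 0`. [folklore] -/
theorem den_ne_zero_of_norm_le {z c : ℂ} (h : ‖c‖ * ‖z‖ ≤ (1 + ‖z‖ ^ 2) / 2) : den z c ≠ 0 := by
  have h1 : (0 : ℝ) < (1 + ‖z‖ ^ 2) / 2 := by positivity
  have h2 := le_norm_den h
  intro h0
  rw [h0, norm_zero] at h2
  linarith

/-- The hypothesis of `den_ne_zero_of_norm_le` holds for `‖z‖ ≤ 3` and `‖c‖ ≤ 1/6`.
[folklore] -/
theorem norm_mul_norm_le_of_norm_le_three {z c : ℂ} (hz : ‖z‖ ≤ 3) (hc : ‖c‖ ≤ 1 / 6) :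
    ‖c‖ * ‖z‖ ≤ (1 + ‖z‖ ^ 2) / 2 := by
  have h1 : ‖c‖ * ‖z‖ ≤ 1 / 6 * 3 := mul_le_mul hc hz (norm_nonneg _) (by norm_num)
  nlinarith [sq_nonneg ‖z‖]

/-- Convenient special case: `den z c ≠ 0` for `‖z‖ ≤ 3` and `‖c‖ ≤ 1/6`. [folklore] -/
theorem den_ne_zero_of_norm_le_three {z c : ℂ} (hz : ‖z‖ ≤ 3) (hc : ‖c‖ ≤ 1 / 6) :
    den z c ≠ 0 :=
  den_ne_zero_of_norm_le (norm_mul_norm_le_of_norm_le_three hz hc)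

/-! ### Values: distance to the base point and Lipschitz dependence on `c` -/

/-- `expChart z c - z = c (1 + |z|²) / den z c` where the denominator is nonzero. [folklore] -/
theorem expChart_sub_self {z c : ℂ} (h : den z c ≠ 0) :
    expChart z c - z = c * (1 + (Complex.normSq z : ℂ)) / den z c := by
  rw [expChart, eq_div_iff h, sub_mul, div_mul_cancel₀ _ h, den, ← Complex.mul_conj]
  ring

/-- `‖expChart z c - z‖ ≤ 2 ‖c‖` as soon as `‖c‖ ‖z‖ ≤ (1 + ‖z‖²)/2` (in particular for
`‖z‖ ≤ 3`, `‖c‖ ≤ 1/6`). [folklore] -/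
theorem norm_expChart_sub_self_le {z c : ℂ} (h : ‖c‖ * ‖z‖ ≤ (1 + ‖z‖ ^ 2) / 2) :
    ‖expChart z c - z‖ ≤ 2 * ‖c‖ := by
  have hB : (0 : ℝ) < 1 + ‖z‖ ^ 2 := by positivity
  have hd := le_norm_den h
  have hd0 : (0 : ℝ) < ‖den z c‖ := lt_of_lt_of_le (by positivity) hd
  rw [expChart_sub_self (den_ne_zero_of_norm_le h), norm_div, norm_mul, norm_one_add_normSq,
    div_le_iff₀ hd0]
  nlinarith [norm_nonneg c]

/-- The difference of two values in the same fibre: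
`expChart z c₁ - expChart z c₂ = (1 + |z|²)² (c₁ - c₂) / (den z c₁ * den z c₂)`. [folklore] -/
theorem expChart_sub_expChart {z c₁ c₂ : ℂ} (h₁ : den z c₁ ≠ 0) (h₂ : den z c₂ ≠ 0) :
    expChart z c₁ - expChart z c₂
      = (1 + (Complex.normSq z : ℂ)) ^ 2 * (c₁ - c₂) / (den z c₁ * den z c₂) := by
  rw [expChart, expChart, div_sub_div _ _ h₁ h₂]
  congr 1
  simp only [den, ← Complex.mul_conj]
  ring

/-- `expChart z ·` is `4`-Lipschitz on `{c | ‖c‖ ‖z‖ ≤ (1 + ‖z‖²)/2}` (in particular on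
`‖c‖ ≤ 1/6` when `‖z‖ ≤ 3`). [folklore] -/
theorem norm_expChart_sub_expChart_le {z c₁ c₂ : ℂ} (h₁ : ‖c₁‖ * ‖z‖ ≤ (1 + ‖z‖ ^ 2) / 2)
    (h₂ : ‖c₂‖ * ‖z‖ ≤ (1 + ‖z‖ ^ 2) / 2) :
    ‖expChart z c₁ - expChart z c₂‖ ≤ 4 * ‖c₁ - c₂‖ := by
  have hB : (0 : ℝ) < 1 + ‖z‖ ^ 2 := by positivity
  have hd₁ := le_norm_den h₁
  have hd₂ := le_norm_den h₂
  have hd0 : (0 : ℝ) < ‖den z c₁‖ * ‖den z c₂‖ :=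
    mul_pos (lt_of_lt_of_le (by positivity) hd₁) (lt_of_lt_of_le (by positivity) hd₂)
  rw [expChart_sub_expChart (den_ne_zero_of_norm_le h₁) (den_ne_zero_of_norm_le h₂), norm_div,
    norm_mul, norm_mul, norm_pow, norm_one_add_normSq, div_le_iff₀ hd0]
  have h4 : (1 + ‖z‖ ^ 2) ^ 2 / 4 ≤ ‖den z c₁‖ * ‖den z c₂‖ := by
    rw [show (1 + ‖z‖ ^ 2) ^ 2 / 4 = ((1 + ‖z‖ ^ 2) / 2) * ((1 + ‖z‖ ^ 2) / 2) by ring]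
    exact mul_le_mul hd₁ hd₂ (by positivity) (norm_nonneg _)
  nlinarith [norm_nonneg (c₁ - c₂)]

/-! ### Equivariance under the chart change `z ↦ z⁻¹` -/

/-- Numerator of `expChart z⁻¹ (-(z⁻¹)² c)`: it is `den z c` times `z⁻² (conj z)⁻¹`. [folklore] -/
theorem num_inv {z : ℂ} (hz : z ≠ 0) (c : ℂ) :
    z⁻¹ * (1 + (Complex.normSq z⁻¹ : ℂ)) + -(z⁻¹) ^ 2 * c
      = den z c * ((z⁻¹) ^ 2 * (conj z)⁻¹) := by
  have hzc : conj z ≠ 0 := (map_ne_zero _).mpr hz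
  simp only [den, map_inv₀, Complex.ofReal_inv, ← Complex.mul_conj]
  field_simp
  ring

/-- Denominator of `expChart z⁻¹ (-(z⁻¹)² c)`: it is the numerator `z (1 + |z|²) + c` of
`expChart z c` times `z⁻² (conj z)⁻¹`. [folklore] -/
theorem den_inv {z : ℂ} (hz : z ≠ 0) (c : ℂ) :
    den z⁻¹ (-(z⁻¹) ^ 2 * c)
      = (z * (1 + (Complex.normSq z : ℂ)) + c) * ((z⁻¹) ^ 2 * (conj z)⁻¹) := by
  have hzc : conj z ≠ 0 := (map_ne_zero _).mpr hz
  simp only [den, map_inv₀, Complex.ofReal_inv, ← Complex.mul_conj]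
  field_simp
  ring

/-- The right-hand side of the equivariance identity is an honest value: for `z ≠ 0` and
`z (1 + |z|²) + c ≠ 0` (the numerator of `expChart z c`; given `den z c ≠ 0` this says
`expChart z c ≠ 0`, see `expChart_eq_zero_iff`), `den z⁻¹ (-(z⁻¹)² c) ≠ 0`. [folklore] -/
theorem den_inv_ne_zero {z c : ℂ} (hz : z ≠ 0)
    (hnum : z * (1 + (Complex.normSq z : ℂ)) + c ≠ 0) :
    den z⁻¹ (-(z⁻¹) ^ 2 * c) ≠ 0 := by
  have hzc : conj z ≠ 0 := (map_ne_zero _).mpr hz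
  rw [den_inv hz]
  exact mul_ne_zero hnum (mul_ne_zero (pow_ne_zero _ (inv_ne_zero hz)) (inv_ne_zero hzc))

/-- Conversely `den z⁻¹ (-(z⁻¹)² c) ≠ 0` forces `z (1 + |z|²) + c ≠ 0` (`z ≠ 0`). [folklore] -/
theorem num_ne_zero_of_den_inv_ne_zero {z c : ℂ} (hz : z ≠ 0)
    (h : den z⁻¹ (-(z⁻¹) ^ 2 * c) ≠ 0) : z * (1 + (Complex.normSq z : ℂ)) + c ≠ 0 := by
  rw [den_inv hz] at h
  exact left_ne_zero_of_mul h

/-- **Equivariance of the exponential chart under `z ↦ 1/z`.**  For `z ≠ 0`,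
`(expChart z c)⁻¹ = expChart z⁻¹ (-(z⁻¹)² c)`: the image point read in the chart `w = 1/z`
is the exponential, at `w = z⁻¹`, of the same tangent vector written in that chart
(`c ∂_z = c₁ ∂_w` with `c₁ = -w² c`).  Thanks to the conventions `x / 0 = 0` and `0⁻¹ = 0` no
nondegeneracy hypothesis is needed; the two sides are honest values under `den z c ≠ 0`,
resp. `z (1 + |z|²) + c ≠ 0` (`den_inv_ne_zero`).  Proof: multiply numerator and
denominator of `1 / expChart z c` by `w² conj w` (`num_inv`, `den_inv`). [folklore] -/
theorem inv_expChart {z : ℂ} (hz : z ≠ 0) (c : ℂ) :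
    (expChart z c)⁻¹ = expChart z⁻¹ (-(z⁻¹) ^ 2 * c) := by
  have hzc : conj z ≠ 0 := (map_ne_zero _).mpr hz
  have hk : (z⁻¹) ^ 2 * (conj z)⁻¹ ≠ 0 :=
    mul_ne_zero (pow_ne_zero _ (inv_ne_zero hz)) (inv_ne_zero hzc)
  rw [expChart, expChart, inv_div, num_inv hz, den_inv hz, mul_div_mul_right _ _ hk]

/-- The equivariance read from the other chart: for `w ≠ 0`,
`(expChart w⁻¹ c)⁻¹ = expChart w (-w² c)`. [folklore] -/
theorem inv_expChart_inv {w : ℂ} (hw : w ≠ 0) (c : ℂ) :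
    (expChart w⁻¹ c)⁻¹ = expChart w (-w ^ 2 * c) := by
  simpa only [inv_inv] using inv_expChart (inv_ne_zero hw) c

/-! ### Derivatives in the fibre variable `c` -/

/-- The complex derivative of `c ↦ expChart z c` is `(1 + |z|²)² / (den z c)²` wherever the
denominator is nonzero. [folklore] -/
theorem hasDerivAt_expChart {z c : ℂ} (h : den z c ≠ 0) :
    HasDerivAt (fun c : ℂ => expChart z c)
      ((1 + (Complex.normSq z : ℂ)) ^ 2 / den z c ^ 2) c := by
  have h1 : HasDerivAt (fun c : ℂ => z * (1 + (Complex.normSq z : ℂ)) + c) 1 c :=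
    (hasDerivAt_id c).const_add _
  have h2 : HasDerivAt (fun c : ℂ => den z c) (-conj z) c :=
    HasDerivAt.const_sub (1 + (Complex.normSq z : ℂ)) (hasDerivAt_mul_const (conj z))
  have h3 := h1.div h2 h
  have key : 1 * den z c - (z * (1 + (Complex.normSq z : ℂ)) + c) * -conj z
      = (1 + (Complex.normSq z : ℂ)) ^ 2 := by
    simp only [den, ← Complex.mul_conj]
    ring
  rw [key] at h3
  exact h3

/-- **The `c`-derivative at `c = 0` is `1`:** `HasDerivAt (expChart z ·) 1 0`. [folklore] -/
theorem hasDerivAt_expChart_zero (z : ℂ) : HasDerivAt (fun c : ℂ => expChart z c) 1 0 := by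
  convert hasDerivAt_expChart (den_zero_ne_zero z) using 1
  rw [den_zero, div_self (pow_ne_zero 2 (one_add_normSq_ne_zero z))]

/-- `c ↦ expChart z c` is holomorphic wherever the denominator is nonzero. [folklore] -/
theorem differentiableAt_expChart_right {z c : ℂ} (h : den z c ≠ 0) :
    DifferentiableAt ℂ (fun c : ℂ => expChart z c) c :=
  (hasDerivAt_expChart h).differentiableAt

/-- The real Fréchet derivative of `c ↦ expChart z c` at `c = 0` is the identity of `ℂ`.
[folklore] -/
theorem hasFDerivAt_expChart_zero_right (z : ℂ) :
    HasFDerivAt (fun c : ℂ => expChart z c) (ContinuousLinearMap.id ℝ ℂ) 0 := by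
  refine (((hasDerivAt_expChart_zero z).hasFDerivAt).restrictScalars ℝ).congr_fderiv ?_
  ext1 v
  simp

/-- The real Fréchet derivative of `z ↦ expChart z 0 = z` is the identity of `ℂ`. [folklore] -/
theorem hasFDerivAt_expChart_zero_left (z : ℂ) :
    HasFDerivAt (fun z : ℂ => expChart z 0) (ContinuousLinearMap.id ℝ ℂ) z := by
  rw [expChart_zero_eq_id]
  exact hasFDerivAt_id z

/-! ### Smoothness and real-analyticity in `(z, c)` -/

/-- `q ↦ conj q.1` on `ℂ × ℂ`, as a continuous `ℝ`-linear map. [folklore] -/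
def conjFst : ℂ × ℂ →L[ℝ] ℂ :=
  (Complex.conjCLE : ℂ →L[ℝ] ℂ).comp (ContinuousLinearMap.fst ℝ ℂ ℂ)

/-- `conjFst v = conj v.1`. [folklore] -/
@[simp]
theorem conjFst_apply (v : ℂ × ℂ) : conjFst v = conj v.1 := rfl

/-- `q ↦ conj q.1` is real-analytic. [folklore] -/
theorem analyticAt_conj_fst (p : ℂ × ℂ) : AnalyticAt ℝ (fun q : ℂ × ℂ => conj q.1) p :=
  conjFst.analyticAt p

/-- The denominator is real-analytic in `(z, c)`. [folklore] -/
theorem analyticAt_den (p : ℂ × ℂ) : AnalyticAt ℝ (fun q : ℂ × ℂ => den q.1 q.2) p := by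
  have h : (fun q : ℂ × ℂ => den q.1 q.2) = fun q => 1 + q.1 * conj q.1 - q.2 * conj q.1 :=
    funext fun q => den_eq q.1 q.2
  rw [h]
  exact (analyticAt_const.add (analyticAt_fst.mul (analyticAt_conj_fst p))).sub
    (analyticAt_snd.mul (analyticAt_conj_fst p))

/-- The denominator is continuous in `(z, c)`. [folklore] -/
theorem continuous_den : Continuous (fun q : ℂ × ℂ => den q.1 q.2) :=
  continuous_iff_continuousAt.2 fun p => (analyticAt_den p).continuousAt

/-- The domain `{(z, c) | den z c ≠ 0}` of the exponential chart is open. [folklore] -/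
theorem isOpen_den_ne_zero : IsOpen {p : ℂ × ℂ | den p.1 p.2 ≠ 0} :=
  isOpen_ne_fun continuous_den continuous_const

/-- The exponential chart is real-analytic in `(z, c)` wherever the denominator is nonzero.
[folklore] -/
theorem analyticAt_expChart {p : ℂ × ℂ} (h : den p.1 p.2 ≠ 0) :
    AnalyticAt ℝ (fun q : ℂ × ℂ => expChart q.1 q.2) p := by
  have hn : AnalyticAt ℝ (fun q : ℂ × ℂ => q.1 * (1 + (Complex.normSq q.1 : ℂ)) + q.2) p := by
    have h' : (fun q : ℂ × ℂ => q.1 * (1 + (Complex.normSq q.1 : ℂ)) + q.2)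
        = fun q => q.1 * (1 + q.1 * conj q.1) + q.2 := by
      funext q; simp only [Complex.mul_conj]
    rw [h']
    exact (analyticAt_fst.mul (analyticAt_const.add (analyticAt_fst.mul
      (analyticAt_conj_fst p)))).add analyticAt_snd
  exact hn.fun_div (analyticAt_den p) h

/-- The exponential chart is real-analytic on the open set `{den ≠ 0}`. [folklore] -/
theorem analyticOnNhd_expChart :
    AnalyticOnNhd ℝ (fun q : ℂ × ℂ => expChart q.1 q.2) {p : ℂ × ℂ | den p.1 p.2 ≠ 0} :=
  fun _ hp => analyticAt_expChart hp

/-- The exponential chart is real-analytic on `{den ≠ 0}` (`AnalyticOn` form). [folklore] -/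
theorem analyticOn_expChart :
    AnalyticOn ℝ (fun q : ℂ × ℂ => expChart q.1 q.2) {p : ℂ × ℂ | den p.1 p.2 ≠ 0} :=
  analyticOnNhd_expChart.analyticOn

/-- The exponential chart is `C^n` in `(z, c)`, for every `n` (including `ω`), at every point
where the denominator is nonzero. [folklore] -/
theorem contDiffAt_expChart {n : WithTop ℕ∞} {p : ℂ × ℂ} (h : den p.1 p.2 ≠ 0) :
    ContDiffAt ℝ n (fun q : ℂ × ℂ => expChart q.1 q.2) p :=
  (analyticAt_expChart h).contDiffAt

/-- **Smoothness:** the exponential chart is `C^∞` in `(z, c)` on the open set `{den ≠ 0}`.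
[folklore] -/
theorem contDiffOn_expChart :
    ContDiffOn ℝ ∞ (fun p : ℂ × ℂ => expChart p.1 p.2) {p : ℂ × ℂ | den p.1 p.2 ≠ 0} :=
  fun _ hp => (contDiffAt_expChart hp).contDiffWithinAt

/-- `C^n` version of `contDiffOn_expChart` for an arbitrary `n : WithTop ℕ∞`. [folklore] -/
theorem contDiffOn_expChart' {n : WithTop ℕ∞} :
    ContDiffOn ℝ n (fun p : ℂ × ℂ => expChart p.1 p.2) {p : ℂ × ℂ | den p.1 p.2 ≠ 0} :=
  fun _ hp => (contDiffAt_expChart hp).contDiffWithinAt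

/-! ### The full real differential -/

/-- The real differential of `(z, c) ↦ expChart z c` at `p = (z, c)`, as an explicit continuous
`ℝ`-linear map `ℂ × ℂ →L[ℝ] ℂ`: with `N = z (1 + |z|²) + c`, `D = den z c`,
`dN (a, b) = a (1 + 2|z|²) + z² conj a + b` and
`dD (a, b) = a conj z + z conj a - b conj z - c conj a`, it is `D⁻¹ dN - (N / D²) dD`
(see `fderivExpChart_apply`, `hasFDerivAt_expChart`). [folklore] -/
def fderivExpChart (p : ℂ × ℂ) : ℂ × ℂ →L[ℝ] ℂ :=
  (den p.1 p.2)⁻¹ •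
      ((1 + 2 * (Complex.normSq p.1 : ℂ)) • ContinuousLinearMap.fst ℝ ℂ ℂ + (p.1 ^ 2) • conjFst
        + ContinuousLinearMap.snd ℝ ℂ ℂ)
    - ((p.1 * (1 + (Complex.normSq p.1 : ℂ)) + p.2) / den p.1 p.2 ^ 2) •
      (conj p.1 • ContinuousLinearMap.fst ℝ ℂ ℂ + p.1 • conjFst
        - conj p.1 • ContinuousLinearMap.snd ℝ ℂ ℂ - p.2 • conjFst)

/-- Evaluation of `fderivExpChart p` on `v = (a, b)`. [folklore] -/
theorem fderivExpChart_apply (p v : ℂ × ℂ) :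
    fderivExpChart p v =
      (den p.1 p.2)⁻¹ * (v.1 * (1 + 2 * (Complex.normSq p.1 : ℂ)) + p.1 ^ 2 * conj v.1 + v.2)
        - (p.1 * (1 + (Complex.normSq p.1 : ℂ)) + p.2) / den p.1 p.2 ^ 2 *
          (v.1 * conj p.1 + p.1 * conj v.1 - v.2 * conj p.1 - p.2 * conj v.1) := by
  simp only [fderivExpChart, sub_apply, add_apply, smul_apply, ContinuousLinearMap.coe_fst',
    ContinuousLinearMap.coe_snd', conjFst_apply, smul_eq_mul]
  ring

/-- **At `c = 0` the differential is `(δz, δc) ↦ δz + δc`:**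
`fderivExpChart (z, 0) (a, b) = a + b`. [folklore] -/
@[simp]
theorem fderivExpChart_zero_apply (z a b : ℂ) : fderivExpChart (z, 0) (a, b) = a + b := by
  have h := one_add_normSq_ne_zero z
  rw [← Complex.mul_conj] at h
  rw [fderivExpChart_apply]
  simp only [den, ← Complex.mul_conj, zero_mul, sub_zero, add_zero]
  field_simp
  ring

/-- **The exponential chart is real-differentiable with differential `fderivExpChart`:**
`HasFDerivAt (fun p => expChart p.1 p.2) (fderivExpChart p) p` wherever `den ≠ 0`.
[folklore] -/
theorem hasFDerivAt_expChart (p : ℂ × ℂ) (h : den p.1 p.2 ≠ 0) :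
    HasFDerivAt (fun q : ℂ × ℂ => expChart q.1 q.2) (fderivExpChart p) p := by
  have hc : HasFDerivAt (fun q : ℂ × ℂ => conj q.1) conjFst p := conjFst.hasFDerivAt
  have h1 : HasFDerivAt (fun q : ℂ × ℂ => q.1) (ContinuousLinearMap.fst ℝ ℂ ℂ) p :=
    hasFDerivAt_fst
  have h2 : HasFDerivAt (fun q : ℂ × ℂ => q.2) (ContinuousLinearMap.snd ℝ ℂ ℂ) p :=
    hasFDerivAt_snd
  have hN := (h1.fun_mul ((hasFDerivAt_const (1 : ℂ) p).fun_add (h1.fun_mul hc))).fun_add h2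
  have hD := ((hasFDerivAt_const (1 : ℂ) p).fun_add (h1.fun_mul hc)).fun_sub (h2.fun_mul hc)
  have hD0 : (1 + p.1 * conj p.1 - p.2 * conj p.1) ≠ 0 := by rwa [← den_eq]
  have hDi := (hasFDerivAt_inv' (𝕜 := ℝ) hD0).comp p hD
  have hE := hN.fun_mul hDi
  have hfun : (fun q : ℂ × ℂ => expChart q.1 q.2) =
      fun q => (q.1 * (1 + q.1 * conj q.1) + q.2) *
        (Inv.inv ∘ fun q : ℂ × ℂ => 1 + q.1 * conj q.1 - q.2 * conj q.1) q := by
    funext q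
    rw [expChart_eq, div_eq_mul_inv, Function.comp_apply]
  rw [hfun]
  refine hE.congr_fderiv (ContinuousLinearMap.ext fun v => ?_)
  rw [fderivExpChart_apply]
  simp only [add_apply, sub_apply, smul_apply, ContinuousLinearMap.comp_apply,
    neg_apply, ContinuousLinearMap.mulLeftRight_apply,
    ContinuousLinearMap.coe_fst', ContinuousLinearMap.coe_snd', conjFst_apply, smul_eq_mul,
    zero_apply, Function.comp_apply, den, ← Complex.mul_conj]
  field_simp
  ring

/-- The exponential chart is real-differentiable at every point of `{den ≠ 0}`. [folklore] -/
theorem differentiableAt_expChart {p : ℂ × ℂ} (h : den p.1 p.2 ≠ 0) :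
    DifferentiableAt ℝ (fun q : ℂ × ℂ => expChart q.1 q.2) p :=
  (hasFDerivAt_expChart p h).differentiableAt

/-- `fderiv ℝ (fun p => expChart p.1 p.2) p = fderivExpChart p` on `{den ≠ 0}`. [folklore] -/
theorem fderiv_expChart {p : ℂ × ℂ} (h : den p.1 p.2 ≠ 0) :
    fderiv ℝ (fun q : ℂ × ℂ => expChart q.1 q.2) p = fderivExpChart p :=
  (hasFDerivAt_expChart p h).fderiv

/-- At a point `(z, 0)` of the zero section the differential of the exponential chart is
`(δz, δc) ↦ δz + δc`. [folklore] -/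
theorem hasFDerivAt_expChart_zero (z : ℂ) :
    HasFDerivAt (fun q : ℂ × ℂ => expChart q.1 q.2)
      (ContinuousLinearMap.fst ℝ ℂ ℂ + ContinuousLinearMap.snd ℝ ℂ ℂ) (z, 0) := by
  refine (hasFDerivAt_expChart (z, 0) (den_zero_ne_zero z)).congr_fderiv
    (ContinuousLinearMap.ext fun v => ?_)
  obtain ⟨a, b⟩ := v
  rw [fderivExpChart_zero_apply]
  rfl

/-- Chain rule along a section: if `ξ : ℂ → ℂ` has real differential `L` at `z` and
`den z (ξ z) ≠ 0`, then `z ↦ expChart z (ξ z)` has differential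
`fderivExpChart (z, ξ z) ∘ (id, L)` at `z`. [folklore] -/
theorem hasFDerivAt_expChart_comp {ξ : ℂ → ℂ} {L : ℂ →L[ℝ] ℂ} {z : ℂ} (hξ : HasFDerivAt ξ L z)
    (h : den z (ξ z) ≠ 0) :
    HasFDerivAt (fun z : ℂ => expChart z (ξ z))
      ((fderivExpChart (z, ξ z)).comp ((ContinuousLinearMap.id ℝ ℂ).prod L)) z := by
  have hc := (hasFDerivAt_expChart (z, ξ z) h).comp z ((hasFDerivAt_id z).prodMk hξ)
  exact hc

/-- **Linearisation at the zero section:** if `ξ z = 0` and `ξ` has real differential `L` at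
`z`, then `z ↦ expChart z (ξ z)` has differential `id + L` at `z`
(`δz ↦ δz + L δz`). [folklore] -/
theorem hasFDerivAt_expChart_comp_of_eq_zero {ξ : ℂ → ℂ} {L : ℂ →L[ℝ] ℂ} {z : ℂ}
    (hξ : HasFDerivAt ξ L z) (h0 : ξ z = 0) :
    HasFDerivAt (fun z : ℂ => expChart z (ξ z)) (ContinuousLinearMap.id ℝ ℂ + L) z := by
  have hden : den z (ξ z) ≠ 0 := by rw [h0]; exact den_zero_ne_zero z
  refine (hasFDerivAt_expChart_comp hξ hden).congr_fderiv (ContinuousLinearMap.ext fun v => ?_)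
  rw [ContinuousLinearMap.comp_apply, ContinuousLinearMap.prod_apply, h0,
    fderivExpChart_zero_apply]
  rfl

end ProjectiveLineExpChart

end Literature.Analysis.Complex
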